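import Summits.CriticalPhenomena.PercolationContinuityZ3.Theorems.PercNearOneGluingNoHeavyLowerTailSahiLatinZeroBottomProduct
import Summits.CriticalPhenomena.PercolationContinuityZ3.Theorems.PercNearOneGluingNoHeavyLowerTailSahiLatinZeroBottomCore

/-!
# `NoHeavyLowerTail` (crux stmt-CriticalPhenomena-4575), Sahi programme (prim-master-conj gen 50): **THE GENERAL CORE BOUND** — the grid
# invariant `Grid4` holds for EVERY core instance `P = S × [3]^V`, `b = Pᶜ`, `Q = [3]^U × T`, `c = Qᶜ` with ARBITRARY block sets `S ⊆ [3]^U`,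
# `T ⊆ [3]^V` (all block sizes, all thresholds, indeed all subsets)

Support file (`--supports stmt-CriticalPhenomena-4575`; one definition (the per-point bound `mCore`) + proofs, no `sorry`, standard axioms).
Memo `run/shared/lean/prim/prim-l12/FROM-prim-master-conj-g50-GENERAL-CORE.md` §§1–4.  Nothing here asserts the crux, Kahn's conjecture or (C¼).

THE MATHEMATICS.  gen 49 reduced top-slice dominance with the sharp constant `3/2` on the conjunctive zero-bottom family to the grid invariant
`Grid4` (`…ZeroBottomGrid`) on CORE instances, proved it for the four single-literal cores on `[3]^2` by `decide` (`…ZeroBottomCoreBridge`) and,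
on paper, for literal boxes of sizes `≤ 20` by an exact table.  THIS FILE proves the core bound for ALL cores at once:
with `α = N_S(ξ)`, `ᾱ = N_{Sᶜ}(ξ)`, `β = N_T(η)`, `β̄ = N_{Tᶜ}(η)` (`α + ᾱ = 2^p`, `β + β̄ = 2^q`, `n = p + q`) the block-independence dictionary
of `…ZeroBottomProduct` turns the four point densities into polynomials (`dSS_core` … `dOO_core`; `dOO ≡ −4ᾱβ̄`), a per-point lower bound over
the admissible membership patterns is
  `m(ξ,η) = 2^pβ + min(2^n, 4ᾱβ)` (`ξ ∈ S, η ∉ T`),  `2^qα + min(2^n, 4αβ̄)` (`ξ ∉ S, η ∈ T`),  `−(2^pβ̄ + 2^qᾱ + 4ᾱβ̄)` (`ξ ∈ S, η ∈ T`),  `0` (else)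
(`mCore`, `mCore_le_pattern`; it is the exact per-point minimum), and **`Σ m ≥ 0`** (`sum_mCore_nonneg`): by the elementary
`min(XY,4xy) ≥ 4xy − 2y(2x−X)⁺ − 2x(2y−Y)⁺` and the ANTIPODE BOUND `(2N_X − 2^d)⁺ ≤ Λ_{X,X}` of `…ZeroBottomBlock`,
`Σ m ≥ 4ĀB̄ − 2B̄·(Σ_{ξ∈S}Λ_{SᶜSᶜ} + Σ_{ξ∉S}Λ_{SS}) − 2Ā·(Σ_{η∈T}Λ_{TᶜTᶜ} + Σ_{η∉T}Λ_{TT})` with `Ā = Σ_{ξ∈S} ᾱ(ξ)` (cross pairs of the cut `S`),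
`B̄` likewise, and the LONELY-VERTEX IDENTITY makes the brackets equal to `Ā`, `B̄`: total `≥ 0`.  Hence (`grid4_core`)
`Grid4 (cylL S) (cylL Sᶜ) (cylR T) (cylR Tᶜ)` for all `U, V, S, T` — the base of the peeling induction for the WHOLE conjunctive zero-bottom
family with arbitrary private blocks (assembled in `…SahiLatinZeroBottomConjFamily`).  The bound is tight exactly at the single bridges (gen 49).
[this work]
-/

namespace Summit.CriticalPhenomena.PercolationContinuityZ3.Theorems.SahiLatin

open Finset

variable {U V : Type*} [Fintype U] [DecidableEq U] [Fintype V] [DecidableEq V]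

/-! ## §1  Closed forms of the four densities on a core instance -/

section closed
variable (S : Finset (Pt U)) (T : Finset (Pt V))

omit [Fintype U] [DecidableEq U] [Fintype V] [DecidableEq V] in
/-- `ind sᶜ x = 1 − ind s x`. [this work] -/
theorem ind_compl' {β : Type*} [Fintype β] [DecidableEq β] (s : Finset β) (x : β) : ind sᶜ x = 1 - ind s x := by
  by_cases h : x ∈ s <;> simp [h]

/-- `dSS` on a core instance: `2·2^p2^q·(1 − [ξ∈S][η∈T])`. [this work] -/
theorem dSS_core (u : Pt (U ⊕ V)) :
    dSS (cylL S : Finset (Pt (U ⊕ V))) (cylL Sᶜ) (cylR T) (cylR Tᶜ) u =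
      2 * (2 ^ Fintype.card U * 2 ^ Fintype.card V) * (1 - ind S (fstPt u) * ind T (sndPt u)) := by
  unfold dSS
  rw [ind_cylL, ind_cylL, ind_cylR, ind_cylR, ind_compl', ind_compl', pow_succ, two_pow_card_sum]
  ring

/-- `dSO` on a core instance: `−[ξ∈S]·2^pβ̄ − [ξ∉S]·2^pβ + 3[ξ∉S]·2^pβ̄`. [this work] -/
theorem dSO_core (u : Pt (U ⊕ V)) :
    dSO (cylL S : Finset (Pt (U ⊕ V))) (cylL Sᶜ) (cylR T) (cylR Tᶜ) u =
      -(ind S (fstPt u) * (2 ^ Fintype.card U * (N Tᶜ (sndPt u) : ℤ)))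
        - (1 - ind S (fstPt u)) * (2 ^ Fintype.card U * (N T (sndPt u) : ℤ))
        + 3 * ((1 - ind S (fstPt u)) * (2 ^ Fintype.card U * (N Tᶜ (sndPt u) : ℤ))) := by
  have dQ : (N (cylR T : Finset (Pt (U ⊕ V))) u : ℤ) = 2 ^ Fintype.card U * N T (sndPt u) := by exact_mod_cast N_cylR T u
  have dc : (N (cylR Tᶜ : Finset (Pt (U ⊕ V))) u : ℤ) = 2 ^ Fintype.card U * N Tᶜ (sndPt u) := by exact_mod_cast N_cylR Tᶜ u
  unfold dSO
  rw [ind_cylL, ind_cylL, ind_compl', dQ, dc]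

/-- `dOS` on a core instance: `−[η∈T]·2^qᾱ − [η∉T]·2^qα + 3[η∉T]·2^qᾱ`. [this work] -/
theorem dOS_core (u : Pt (U ⊕ V)) :
    dOS (cylL S : Finset (Pt (U ⊕ V))) (cylL Sᶜ) (cylR T) (cylR Tᶜ) u =
      -(ind T (sndPt u) * ((N Sᶜ (fstPt u) : ℤ) * 2 ^ Fintype.card V))
        - (1 - ind T (sndPt u)) * ((N S (fstPt u) : ℤ) * 2 ^ Fintype.card V)
        + 3 * ((1 - ind T (sndPt u)) * ((N Sᶜ (fstPt u) : ℤ) * 2 ^ Fintype.card V)) := by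
  have dP : (N (cylL S : Finset (Pt (U ⊕ V))) u : ℤ) = N S (fstPt u) * 2 ^ Fintype.card V := by exact_mod_cast N_cylL S u
  have db : (N (cylL Sᶜ : Finset (Pt (U ⊕ V))) u : ℤ) = N Sᶜ (fstPt u) * 2 ^ Fintype.card V := by exact_mod_cast N_cylL Sᶜ u
  unfold dOS
  rw [ind_cylR, ind_cylR, ind_compl', dP, db]

/-- `dOO` on a core instance: `−4ᾱβ̄` (block independence). [this work] -/
theorem dOO_core (u : Pt (U ⊕ V)) :
    dOO (cylL S : Finset (Pt (U ⊕ V))) (cylL Sᶜ) (cylR T) (cylR Tᶜ) u = -4 * ((N Sᶜ (fstPt u) : ℤ) * (N Tᶜ (sndPt u) : ℤ)) := by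
  have dQb : (N ((cylR T : Finset (Pt (U ⊕ V))) ∩ cylL Sᶜ) u : ℤ) = N Sᶜ (fstPt u) * N T (sndPt u) := by
    rw [inter_comm]; exact_mod_cast N_cylL_inter_cylR Sᶜ T u
  have dPc : (N ((cylL S : Finset (Pt (U ⊕ V))) ∩ cylR Tᶜ) u : ℤ) = N S (fstPt u) * N Tᶜ (sndPt u) := by
    exact_mod_cast N_cylL_inter_cylR S Tᶜ u
  have dbc : (N ((cylL Sᶜ : Finset (Pt (U ⊕ V))) ∩ cylR Tᶜ) u : ℤ) = N Sᶜ (fstPt u) * N Tᶜ (sndPt u) := by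
    exact_mod_cast N_cylL_inter_cylR Sᶜ Tᶜ u
  have lPc : (Lam (cylL S : Finset (Pt (U ⊕ V))) (cylR Tᶜ) u : ℤ) = N S (fstPt u) * N Tᶜ (sndPt u) := by
    exact_mod_cast Lam_cylL_cylR S Tᶜ u
  have lbQ : (Lam (cylL Sᶜ : Finset (Pt (U ⊕ V))) (cylR T) u : ℤ) = N Sᶜ (fstPt u) * N T (sndPt u) := by
    exact_mod_cast Lam_cylL_cylR Sᶜ T u
  have lbc : (Lam (cylL Sᶜ : Finset (Pt (U ⊕ V))) (cylR Tᶜ) u : ℤ) = N Sᶜ (fstPt u) * N Tᶜ (sndPt u) := by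
    exact_mod_cast Lam_cylL_cylR Sᶜ Tᶜ u
  unfold dOO
  rw [dQb, dPc, dbc, lPc, lbQ, lbc]
  ring

end closed

/-! ## §2  The per-point bound and the pattern inequalities -/

/-- The per-point lower bound `m(ξ,η)` of the general core (the minimum over the admissible membership patterns). [this work] -/
def mCore (S : Finset (Pt U)) (T : Finset (Pt V)) (u : Pt (U ⊕ V)) : ℤ :=
  if fstPt u ∈ S then
    (if sndPt u ∈ T then
      -(2 ^ Fintype.card U * (N Tᶜ (sndPt u) : ℤ) + 2 ^ Fintype.card V * (N Sᶜ (fstPt u) : ℤ)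
        + 4 * ((N Sᶜ (fstPt u) : ℤ) * (N Tᶜ (sndPt u) : ℤ)))
     else 2 ^ Fintype.card U * (N T (sndPt u) : ℤ)
        + min (2 ^ Fintype.card U * 2 ^ Fintype.card V) (4 * ((N Sᶜ (fstPt u) : ℤ) * (N T (sndPt u) : ℤ))))
  else
    (if sndPt u ∈ T then 2 ^ Fintype.card V * (N S (fstPt u) : ℤ)
        + min (2 ^ Fintype.card U * 2 ^ Fintype.card V) (4 * ((N S (fstPt u) : ℤ) * (N Tᶜ (sndPt u) : ℤ)))
     else 0)

section pattern
variable (S : Finset (Pt U)) (T : Finset (Pt V))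

/-- **Pattern inequalities**: `mCore` is below the value of every admissible membership pattern at every point. [this work] -/
theorem mCore_le_pattern (u : Pt (U ⊕ V)) (sSS sSO sOS sOO : Bool)
    (hok : PatternOK (cylL S : Finset (Pt (U ⊕ V))) (cylR T) u sSS sSO sOS sOO) :
    mCore S T u ≤
      (if sSS then dSS (cylL S : Finset (Pt (U ⊕ V))) (cylL Sᶜ) (cylR T) (cylR Tᶜ) u else 0)
      + (if sSO then dSO (cylL S : Finset (Pt (U ⊕ V))) (cylL Sᶜ) (cylR T) (cylR Tᶜ) u else 0)
      + (if sOS then dOS (cylL S : Finset (Pt (U ⊕ V))) (cylL Sᶜ) (cylR T) (cylR Tᶜ) u else 0)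
      + (if sOO then dOO (cylL S : Finset (Pt (U ⊕ V))) (cylL Sᶜ) (cylR T) (cylR Tᶜ) u else 0) := by
  rw [dSS_core, dSO_core, dOS_core, dOO_core]
  unfold PatternOK at hok
  simp only [mem_union, mem_cylL, mem_cylR] at hok
  obtain ⟨n1, n2, n3, n4, f1, f2, f3⟩ := hok
  -- numeric facts about the block counts
  have hα : (N S (fstPt u) : ℤ) + N Sᶜ (fstPt u) = 2 ^ Fintype.card U := by exact_mod_cast N_add_N_compl S (fstPt u)
  have hβ : (N T (sndPt u) : ℤ) + N Tᶜ (sndPt u) = 2 ^ Fintype.card V := by exact_mod_cast N_add_N_compl T (sndPt u)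
  have ha0 : (0 : ℤ) ≤ N S (fstPt u) := by positivity
  have hab0 : (0 : ℤ) ≤ N Sᶜ (fstPt u) := by positivity
  have hb0 : (0 : ℤ) ≤ N T (sndPt u) := by positivity
  have hbb0 : (0 : ℤ) ≤ N Tᶜ (sndPt u) := by positivity
  have hX : (0 : ℤ) < 2 ^ Fintype.card U := by positivity
  have hY : (0 : ℤ) < 2 ^ Fintype.card V := by positivity
  unfold mCore
  by_cases hξ : fstPt u ∈ S <;> by_cases hη : sndPt u ∈ T <;>
    simp only [hξ, hη, ind_apply, if_true, if_false] <;>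
    generalize (N S (fstPt u) : ℤ) = a at hα ha0 ⊢ <;>
    generalize (N Sᶜ (fstPt u) : ℤ) = ab at hα hab0 ⊢ <;>
    generalize (N T (sndPt u) : ℤ) = bt at hβ hb0 ⊢ <;>
    generalize (N Tᶜ (sndPt u) : ℤ) = bb at hβ hbb0 ⊢ <;>
    generalize (2 : ℤ) ^ Fintype.card U = X at hα hX ⊢ <;>
    generalize (2 : ℤ) ^ Fintype.card V = Y at hβ hY ⊢ <;>
    cases sSS <;> cases sSO <;> cases sOS <;> cases sOO
  all_goals first
    | exact absurd (n1 rfl) Bool.false_ne_true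
    | exact absurd (n2 rfl) Bool.false_ne_true
    | exact absurd (n3 rfl) Bool.false_ne_true
    | exact absurd (n4 rfl) Bool.false_ne_true
    | exact absurd (f1 (Or.inl hξ)) Bool.false_ne_true
    | exact absurd (f1 (Or.inr hη)) Bool.false_ne_true
    | exact absurd (f2 hξ) Bool.false_ne_true
    | exact absurd (f3 hη) Bool.false_ne_true
    | (simp only [Bool.false_eq_true, if_true, if_false, add_zero]
       nlinarith [min_le_left (X * Y) (4 * (ab * bt)), min_le_right (X * Y) (4 * (ab * bt)),
         min_le_left (X * Y) (4 * (a * bb)), min_le_right (X * Y) (4 * (a * bb)),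
         mul_nonneg ha0 hb0, mul_nonneg ha0 hbb0, mul_nonneg hab0 hb0, mul_nonneg hab0 hbb0,
         mul_nonneg hab0 hY.le, mul_nonneg ha0 hY.le, mul_nonneg hX.le hb0, mul_nonneg hX.le hbb0, mul_pos hX hY])

end pattern

/-! ## §3  The sum of the per-point bound is nonnegative -/

section sum
variable (S : Finset (Pt U)) (T : Finset (Pt V))

/-- Region 1 (`ξ ∈ S`, `η ∉ T`): the linearised lower bound. [this work] -/
theorem mCore_region1_ge (ξ : Pt U) (η : Pt V) :
    2 ^ Fintype.card U * (N T η : ℤ) + 4 * ((N Sᶜ ξ : ℤ) * (N T η : ℤ))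
      - 2 * (N T η : ℤ) * (Lam Sᶜ Sᶜ ξ : ℤ) - 2 * (N Sᶜ ξ : ℤ) * (Lam T T η : ℤ)
      ≤ 2 ^ Fintype.card U * (N T η : ℤ)
        + min (2 ^ Fintype.card U * 2 ^ Fintype.card V) (4 * ((N Sᶜ ξ : ℤ) * (N T η : ℤ))) := by
  have h := four_mul_sub_le_min (x := (N Sᶜ ξ : ℤ)) (X := 2 ^ Fintype.card U) (y := (N T η : ℤ)) (Y := 2 ^ Fintype.card V)
    (l₁ := (Lam Sᶜ Sᶜ ξ : ℤ)) (l₂ := (Lam T T η : ℤ)) (by positivity) (by exact_mod_cast N_le Sᶜ ξ) (by positivity)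
    (by exact_mod_cast N_le T η) (two_mul_N_sub_pow_le_Lam Sᶜ ξ) (by positivity) (two_mul_N_sub_pow_le_Lam T η) (by positivity)
  rw [show (4 : ℤ) * ((N Sᶜ ξ : ℤ) * (N T η : ℤ)) = 4 * (N Sᶜ ξ : ℤ) * (N T η : ℤ) by ring]
  linarith

/-- Region 2 (`ξ ∉ S`, `η ∈ T`): the linearised lower bound. [this work] -/
theorem mCore_region2_ge (ξ : Pt U) (η : Pt V) :
    2 ^ Fintype.card V * (N S ξ : ℤ) + 4 * ((N S ξ : ℤ) * (N Tᶜ η : ℤ))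
      - 2 * (N Tᶜ η : ℤ) * (Lam S S ξ : ℤ) - 2 * (N S ξ : ℤ) * (Lam Tᶜ Tᶜ η : ℤ)
      ≤ 2 ^ Fintype.card V * (N S ξ : ℤ)
        + min (2 ^ Fintype.card U * 2 ^ Fintype.card V) (4 * ((N S ξ : ℤ) * (N Tᶜ η : ℤ))) := by
  have h := four_mul_sub_le_min (x := (N S ξ : ℤ)) (X := 2 ^ Fintype.card U) (y := (N Tᶜ η : ℤ)) (Y := 2 ^ Fintype.card V)
    (l₁ := (Lam S S ξ : ℤ)) (l₂ := (Lam Tᶜ Tᶜ η : ℤ)) (by positivity) (by exact_mod_cast N_le S ξ) (by positivity)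
    (by exact_mod_cast N_le Tᶜ η) (two_mul_N_sub_pow_le_Lam S ξ) (by positivity) (two_mul_N_sub_pow_le_Lam Tᶜ η) (by positivity)
  rw [show (4 : ℤ) * ((N S ξ : ℤ) * (N Tᶜ η : ℤ)) = 4 * (N S ξ : ℤ) * (N Tᶜ η : ℤ) by ring]
  linarith

/-- The double sum of `mCore` split by the three nonzero regions. [this work] -/
theorem sum_mCore_eq :
    ∑ u, mCore S T u =
      ∑ ξ ∈ S, ∑ η ∈ T, -(2 ^ Fintype.card U * (N Tᶜ η : ℤ) + 2 ^ Fintype.card V * (N Sᶜ ξ : ℤ)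
            + 4 * ((N Sᶜ ξ : ℤ) * (N Tᶜ η : ℤ)))
      + ∑ ξ ∈ S, ∑ η ∈ Tᶜ, (2 ^ Fintype.card U * (N T η : ℤ)
            + min (2 ^ Fintype.card U * 2 ^ Fintype.card V) (4 * ((N Sᶜ ξ : ℤ) * (N T η : ℤ))))
      + ∑ ξ ∈ Sᶜ, ∑ η ∈ T, (2 ^ Fintype.card V * (N S ξ : ℤ)
            + min (2 ^ Fintype.card U * 2 ^ Fintype.card V) (4 * ((N S ξ : ℤ) * (N Tᶜ η : ℤ)))) := by
  rw [sum_pt_sum_eq, ← sum_add_sum_compl S, ← sum_add_distrib]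
  congr 1
  · refine sum_congr rfl fun ξ hξ => ?_
    rw [← sum_add_sum_compl T]
    congr 1
    · exact sum_congr rfl fun η hη => by simp [mCore, hξ, hη]
    · exact sum_congr rfl fun η hη => by rw [mem_compl] at hη; simp [mCore, hξ, hη]
  · refine sum_congr rfl fun ξ hξ => ?_
    rw [mem_compl] at hξ
    rw [← sum_add_sum_compl T]
    have h0 : ∑ η ∈ Tᶜ, mCore S T (Sum.elim ξ η) = 0 :=
      sum_eq_zero fun η hη => by rw [mem_compl] at hη; simp [mCore, hξ, hη]
    rw [h0, add_zero]
    exact sum_congr rfl fun η hη => by simp [mCore, hξ, hη]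

/-- Region 3 sum in closed form. [this work] -/
theorem sum_region3_eq :
    ∑ ξ ∈ S, ∑ η ∈ T, -(2 ^ Fintype.card U * (N Tᶜ η : ℤ) + 2 ^ Fintype.card V * (N Sᶜ ξ : ℤ)
        + 4 * ((N Sᶜ ξ : ℤ) * (N Tᶜ η : ℤ)))
      = -(2 ^ Fintype.card U * S.card * (∑ η ∈ T, (N Tᶜ η : ℤ)) + 2 ^ Fintype.card V * T.card * (∑ ξ ∈ S, (N Sᶜ ξ : ℤ))
          + 4 * ((∑ ξ ∈ S, (N Sᶜ ξ : ℤ)) * (∑ η ∈ T, (N Tᶜ η : ℤ)))) := by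
  simp only [sum_neg_distrib, sum_add_distrib, sum_const, nsmul_eq_mul, ← mul_sum, ← sum_mul]
  ring

/-- Region 1 linearised sum in closed form. [this work] -/
theorem sum_region1_eq :
    ∑ ξ ∈ S, ∑ η ∈ Tᶜ, (2 ^ Fintype.card U * (N T η : ℤ) + 4 * ((N Sᶜ ξ : ℤ) * (N T η : ℤ))
        - 2 * (N T η : ℤ) * (Lam Sᶜ Sᶜ ξ : ℤ) - 2 * (N Sᶜ ξ : ℤ) * (Lam T T η : ℤ))
      = 2 ^ Fintype.card U * S.card * (∑ η ∈ Tᶜ, (N T η : ℤ))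
        + 4 * ((∑ ξ ∈ S, (N Sᶜ ξ : ℤ)) * (∑ η ∈ Tᶜ, (N T η : ℤ)))
        - 2 * (∑ η ∈ Tᶜ, (N T η : ℤ)) * (∑ ξ ∈ S, (Lam Sᶜ Sᶜ ξ : ℤ))
        - 2 * (∑ ξ ∈ S, (N Sᶜ ξ : ℤ)) * (∑ η ∈ Tᶜ, (Lam T T η : ℤ)) := by
  simp only [sum_sub_distrib, sum_add_distrib, sum_const, nsmul_eq_mul, ← mul_sum, ← sum_mul]
  ring

/-- Region 2 linearised sum in closed form. [this work] -/
theorem sum_region2_eq :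
    ∑ ξ ∈ Sᶜ, ∑ η ∈ T, (2 ^ Fintype.card V * (N S ξ : ℤ) + 4 * ((N S ξ : ℤ) * (N Tᶜ η : ℤ))
        - 2 * (N Tᶜ η : ℤ) * (Lam S S ξ : ℤ) - 2 * (N S ξ : ℤ) * (Lam Tᶜ Tᶜ η : ℤ))
      = 2 ^ Fintype.card V * T.card * (∑ ξ ∈ Sᶜ, (N S ξ : ℤ))
        + 4 * ((∑ ξ ∈ Sᶜ, (N S ξ : ℤ)) * (∑ η ∈ T, (N Tᶜ η : ℤ)))
        - 2 * (∑ η ∈ T, (N Tᶜ η : ℤ)) * (∑ ξ ∈ Sᶜ, (Lam S S ξ : ℤ))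
        - 2 * (∑ ξ ∈ Sᶜ, (N S ξ : ℤ)) * (∑ η ∈ T, (Lam Tᶜ Tᶜ η : ℤ)) := by
  simp only [sum_sub_distrib, sum_add_distrib, sum_const, nsmul_eq_mul, ← mul_sum, ← sum_mul]
  ring

/-- The final bookkeeping: the three region sums against the two lonely-vertex identities. [this work] -/
theorem core_bookkeeping {X Y cS cT A B L1 L2 L3 L4 R1 R2 : ℤ}
    (H1 : X * cS * B + 4 * (A * B) - 2 * B * L1 - 2 * A * L4 ≤ R1)
    (H2 : Y * cT * A + 4 * (A * B) - 2 * B * L2 - 2 * A * L3 ≤ R2)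
    (eLU : L1 + L2 = A) (eLV : L3 + L4 = B) :
    0 ≤ -(X * cS * B + Y * cT * A + 4 * (A * B)) + R1 + R2 := by
  have k1 : B * L1 + B * L2 = B * A := by rw [← mul_add, eLU]
  have k2 : A * L3 + A * L4 = A * B := by rw [← mul_add, eLV]
  linarith

/-- **The core bound**: `0 ≤ Σ_u mCore(u)`. [this work] -/
theorem sum_mCore_nonneg : 0 ≤ ∑ u, mCore S T u := by
  have H1 := sum_le_sum fun ξ (_ : ξ ∈ S) => sum_le_sum fun η (_ : η ∈ Tᶜ) => mCore_region1_ge S T ξ η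
  have H2 := sum_le_sum fun ξ (_ : ξ ∈ Sᶜ) => sum_le_sum fun η (_ : η ∈ T) => mCore_region2_ge S T ξ η
  rw [sum_region1_eq, ← sum_N_comm T Tᶜ] at H1
  rw [sum_region2_eq, ← sum_N_comm S Sᶜ] at H2
  rw [sum_mCore_eq, sum_region3_eq]
  exact core_bookkeeping H1 H2 (sum_Lam_compl_add_sum_Lam_eq S) (sum_Lam_compl_add_sum_Lam_eq T)

end sum

/-! ## §4  The general core instance of the grid invariant -/

/-- **THE GENERAL CORE**: `Grid4 (S × Ω) (Sᶜ × Ω) (Ω × T) (Ω × Tᶜ)` for all finite `U, V` and ALL `S ⊆ [3]^U`, `T ⊆ [3]^V`. [this work] -/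
theorem grid4_core (S : Finset (Pt U)) (T : Finset (Pt V)) :
    Grid4 (cylL S : Finset (Pt (U ⊕ V))) (cylL Sᶜ) (cylR T) (cylR Tᶜ) :=
  grid4_of_pointwise (mCore S T) (sum_mCore_nonneg S T) fun u sSS sSO sOS sOO hok => mCore_le_pattern S T u sSS sSO sOS sOO hok

end Summit.CriticalPhenomena.PercolationContinuityZ3.Theorems.SahiLatin
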